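import Summits.RiemannHypothesis.RiemannHypothesis.Theorems.GroundBartaEvenWinsBeyondArchDeflationWeightedRitz
import Summits.RiemannHypothesis.RiemannHypothesis.Theorems.GroundBartaEvenWinsBeyondArchDeflationBound
import HarnessLib

/-!
# Gap certificates from deflated Temple data, I: the weighted deflated Temple inclusion WITH A RANK-ONE PENALTY
(route `RiemannHypothesis/GroundBarta`, crux `PolarPerronFrobenius` = stmt-RiemannHypothesis-18390, helper; RH-free, no
definitions, no named facts, no sorry)

The deflated Temple (Lehmann–Maehly) machinery of the parity ladder (`EvenWinsBeyondArch.dt_deflation_core_w`,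
`dt_sector_bound_w`, prover A g4 / prover B g3) proves `λ ∫|φ|² ≤ Re Q(φ)` for the window tests `φ` of a sector from Ritz
data `v_i`, window images `F_i`, a low-precision complement certificate and the kernel datum `A − λG − R_w ⪰ 0`; with
`λ = 0` this is a positivity block, and `λ` can never exceed the sector bottom.  The GAP CERTIFICATE consumed by
`GroundBartaPolarPerronFrobeniusGapTransfer` (`gapCertificate_of_deflation`) is the same inequality for the form shifted
UP by a rank-one penalty along an explicit direction `ψ = Σ_l c_l v_l` in the trial span:

  `λ ∫|φ|² ≤ Re Q(φ) + K |Σ_l c_l ∫ φ v̄_l|²`,   `K` real (in practice `≥ 0`),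

and for THAT the kernel datum is `A − λG − R_w + K d dᵀ ⪰ 0`, `d_i = Σ_l c_l G_li` — positive semidefinite as soon as
`A − λG − R_w` is positive on the `G`-orthogonal complement of the bottom Ritz vector, i.e. for `λ` up to (nearly) the
SECOND Ritz level minus its Temple defect.  The abstract two-space lemma `dt_deflatedFormBound₂W` is applied verbatim to
the penalised form `E' = E + K ℓ ⊗ ℓ`, `ℓ(f) = Σ_l c_l ∫Re(v_l f̄)`: the penalty vanishes on the complement of the trial
span, so representation and complement hypotheses are unchanged; only the finite matrix and the conclusion move.

* `gc_deflation_core_wK` — the weighted inclusion with penalty on the sector form domain (copy of `dt_deflation_core_w`).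
* `gc_penalty_split` — `|Σ_l c_l ∫ φ v̄_l|² = (Σ_l c_l ∫Re(v_l φ̄_R))² + (Σ_l c_l ∫Re(v_l φ̄_I))²` for real `v_l`.
* `gc_sector_bound_wK` — the bound with penalty on smooth sector tests (copy of `dt_sector_bound_w`).

References: A. Weinstein, W. Stenger, *Methods of Intermediate Problems for Eigenvalues* (1972) Ch. 5 §9;
N. J. Lehmann, Numer. Math. 5 (1963) 246–272; E. Bombieri, Rend. Mat. Acc. Lincei (9) 11 (2000) Thm 2, §4.
Prover B, speedrun unit `sr-gb-rung-b` (gen 17).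
-/

set_option linter.dupNamespace false

noncomputable section

open MeasureTheory Set Filter
open scoped Topology ENNReal NNReal ComplexConjugate InnerProductSpace BigOperators

namespace Summit.RiemannHypothesis.RiemannHypothesis.Theorems.PolarPerronFrobenius

open Literature.NumberTheory.LFunctions Literature.NumberTheory.LFunctions.ConnesVanSuijlekom
open Summit.RiemannHypothesis.RiemannHypothesis.Theorems.EvenWinsBeyondArch
open Summit.RiemannHypothesis.RiemannHypothesis.Theorems.OddSector
  (weilIncrement₂ weilDirichletEnergy₂ weilPoleForm₂ weilIncrement₂_self weilDirichletEnergy₂_self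
    weilPoleForm₂_self re_mul_conj_self isWeilTest_rePart isWeilTest_imPart tsupport_rePart_subset
    tsupport_imPart_subset integral_norm_sq_rePart_add_imPart re_weilQuadratic_eq_rePart_add_imPart)

/-! ## The weighted inclusion with a rank-one penalty on the sector form domain -/

/-- **Deflated Temple inclusion with a pointwise complement level and a rank-one penalty.**  Data as in
`dt_deflation_core_w` (`c > 0`, parity `σ`, trial vectors `v_i` in the sector form domain with window images `F_i`,
coefficients `W`, real `λ`, weights `n, w ≥ 0` bounded measurable with `w n = 1`, the weighted complement bound for
`h ⊥ v`), plus a real `K` and coefficients `c_l`; if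
`A − λG − R_w + K d dᵀ ⪰ 0` with `d_i = Σ_l c_l ∫Re(v_l v̄_i)`, then every `g` in the sector form domain satisfies
`λ ∫|g|² ≤ P(g) + 𝓔_c(g) − M_c∫|g|² + K (Σ_l c_l ∫Re(v_l ḡ))²`.
[cite: WeinsteinStenger1972, Ch. 5 §9 eq. (2) (k = 1: Temple's formula)] -/
theorem gc_deflation_core_wK {c : ℝ} (σ : ℂ) {k : ℕ} (v F : Fin k → ℝ → ℂ) (W : Fin k → Fin k → ℝ) (lam : ℝ)
    (K : ℝ) (cv : Fin k → ℝ)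
    {n w : ℝ → ℝ} (hnm : Measurable n) (hwm : Measurable w) {C : ℝ} (hnC : ∀ y, |n y| ≤ C) (hwC : ∀ y, |w y| ≤ C)
    (hn0 : ∀ y, 0 ≤ n y) (hw0 : ∀ y, 0 ≤ w y) (hwn : ∀ y, w y * n y = 1)
    (hv : ∀ i, MemLp (v i) 2 ∧ (∀ x, x ∉ Icc (-c) c → v i x = 0) ∧ (∀ x, (v i x).im = 0) ∧
      (∀ x, v i (-x) = σ * v i x) ∧ IntegrableOn (fun t ↦ weilArchDensity t * weilIncrement (v i) t) (Ioi 0))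
    (hF : ∀ i, MemLp (F i) 2)
    (hrepr : ∀ i (f : ℝ → ℂ), MemLp f 2 → (∀ x, x ∉ Icc (-c) c → f x = 0) → (∀ x, (f x).im = 0) →
      (∀ x, f (-x) = σ * f x) → IntegrableOn (fun t ↦ weilArchDensity t * weilIncrement f t) (Ioi 0) →
      weilPoleForm₂ (v i) f + weilDirichletEnergy₂ c (v i) f -
          weilMarkovConstant c * ∫ x, (v i x * conj (f x)).re = ∫ x, (F i x * conj (f x)).re)
    (hbeta : ∀ h : ℝ → ℂ, MemLp h 2 → (∀ x, x ∉ Icc (-c) c → h x = 0) → (∀ x, (h x).im = 0) →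
      (∀ x, h (-x) = σ * h x) → IntegrableOn (fun t ↦ weilArchDensity t * weilIncrement h t) (Ioi 0) →
      (∀ j, ∫ x, (v j x * conj (h x)).re = 0) →
      (∫ y, n y * ‖h y‖ ^ 2) + lam * ∫ y, ‖h y‖ ^ 2 ≤
        weilPoleForm h + weilDirichletEnergy c h - weilMarkovConstant c * ∫ x, ‖h x‖ ^ 2)
    (hPSD : ∀ α : Fin k → ℝ, 0 ≤ ∑ i, ∑ j, α i * α j *
      ((weilPoleForm₂ (v i) (v j) + weilDirichletEnergy₂ c (v i) (v j) -
          weilMarkovConstant c * ∫ x, (v i x * conj (v j x)).re) - lam * (∫ x, (v i x * conj (v j x)).re) -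
        (∫ y, w y * ((F i - ∑ l, W i l • v l) y * conj ((F j - ∑ l, W j l • v l) y)).re) +
        K * ((∑ l, cv l * ∫ x, (v l x * conj (v i x)).re) * (∑ l, cv l * ∫ x, (v l x * conj (v j x)).re))))
    {g : ℝ → ℂ} (hg : MemLp g 2) (hgs : ∀ x, x ∉ Icc (-c) c → g x = 0) (hgr : ∀ x, (g x).im = 0)
    (hgp : ∀ x, g (-x) = σ * g x)
    (hgE : IntegrableOn (fun t ↦ weilArchDensity t * weilIncrement g t) (Ioi 0)) :
    lam * ∫ x, ‖g x‖ ^ 2 ≤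
      (weilPoleForm g + weilDirichletEnergy c g - weilMarkovConstant c * ∫ x, ‖g x‖ ^ 2) +
        K * (∑ l, cv l * ∫ x, (v l x * conj (g x)).re) ^ 2 := by
  classical
  -- adapted from EvenWinsBeyondArch.dt_deflation_core_w (…DeflationWeightedCore): the form gets the penalty `K ℓ ⊗ ℓ`
  let D' : Submodule ℝ (ℝ → ℂ) :=
    { carrier := {f | MemLp f 2 volume}
      add_mem' := fun {f₁ f₂} h₁ h₂ ↦ MemLp.add h₁ h₂
      zero_mem' := MemLp.zero
      smul_mem' := fun a f hf ↦ by
        have e : a • f = fun x ↦ (a : ℂ) * f x := funext fun x ↦ dt_smul_apply a f x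
        rw [e]
        exact hf.const_mul _ }
  let D : Submodule ℝ (ℝ → ℂ) :=
    { carrier := {f | MemLp f 2 volume ∧ (∀ x, x ∉ Icc (-c) c → f x = 0) ∧ (∀ x, (f x).im = 0) ∧
        (∀ x, f (-x) = σ * f x) ∧ IntegrableOn (fun t ↦ weilArchDensity t * weilIncrement f t) (Ioi 0)}
      add_mem' := fun {f₁ f₂} h₁ h₂ ↦ ⟨h₁.1.add h₂.1, fun x hx ↦ by simp [h₁.2.1 x hx, h₂.2.1 x hx],
        fun x ↦ by simp [h₁.2.2.1 x, h₂.2.2.1 x], fun x ↦ by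
          simp only [Pi.add_apply, h₁.2.2.2.1 x, h₂.2.2.2.1 x]; ring,
        dt_finiteEnergy_add h₁.1 h₂.1 h₁.2.2.2.2 h₂.2.2.2.2⟩
      zero_mem' := ⟨MemLp.zero, fun _ _ ↦ rfl, fun _ ↦ rfl, fun _ ↦ by simp, dt_finiteEnergy_zero⟩
      smul_mem' := fun a f hf ↦ ⟨by
          have e : a • f = fun x ↦ (a : ℂ) * f x := funext fun x ↦ dt_smul_apply a f x
          rw [e]; exact hf.1.const_mul _,
        fun x hx ↦ by simp [hf.2.1 x hx], fun x ↦ by simp [hf.2.2.1 x],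
        fun x ↦ by rw [dt_smul_apply, dt_smul_apply, hf.2.2.2.1 x]; ring,
        dt_finiteEnergy_smul a f hf.2.2.2.2⟩ }
  have hDD' : D ≤ D' := fun f hf ↦ hf.1
  let ι : D →ₗ[ℝ] D' := Submodule.inclusion hDD'
  let ip : D' →ₗ[ℝ] D' →ₗ[ℝ] ℝ := LinearMap.mk₂ ℝ
    (fun f h ↦ ∫ x, ((f : ℝ → ℂ) x * conj ((h : ℝ → ℂ) x)).re)
    (fun f₁ f₂ h ↦ by
      simp only [Submodule.coe_add]
      exact dt_pairing_add_left f₁.2 f₂.2 h.2)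
    (fun a f h ↦ by
      simp only [Submodule.coe_smul, smul_eq_mul]
      exact dt_pairing_smul_left a _ _)
    (fun f h₁ h₂ ↦ by
      simp only [Submodule.coe_add]
      rw [dt_pairing_comm, dt_pairing_add_left h₁.2 h₂.2 f.2, dt_pairing_comm (h₁ : ℝ → ℂ),
        dt_pairing_comm (h₂ : ℝ → ℂ)])
    (fun a f h ↦ by
      simp only [Submodule.coe_smul, smul_eq_mul]
      rw [dt_pairing_comm, dt_pairing_smul_left, dt_pairing_comm])
  have hip : ∀ f h : D', ip f h = ∫ x, ((f : ℝ → ℂ) x * conj ((h : ℝ → ℂ) x)).re := fun f h ↦ rfl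
  have hsqC : ∀ {u : ℝ → ℝ}, (∀ y, |u y| ≤ C) → ∀ y, |Real.sqrt (u y)| ≤ Real.sqrt C := fun huC y ↦ by
    rw [abs_of_nonneg (Real.sqrt_nonneg _)]
    exact Real.sqrt_le_sqrt ((le_abs_self _).trans (huC y))
  let S : ∀ u : ℝ → ℝ, Measurable u → (∀ y, |u y| ≤ C) → (D' →ₗ[ℝ] D') := fun u hum huC ↦
    { toFun := fun f ↦ ⟨fun y ↦ ((Real.sqrt (u y) : ℝ) : ℂ) * (f : ℝ → ℂ) y,
        dt_memLp_real_mul hum.sqrt (hsqC huC) f.2⟩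
      map_add' := fun f₁ f₂ ↦ by
        apply Subtype.ext; funext y
        simp only [Submodule.coe_add, Pi.add_apply, mul_add]
      map_smul' := fun a f ↦ by
        apply Subtype.ext; funext y
        simp only [Submodule.coe_smul, RingHom.id_apply, dt_smul_apply]
        ring }
  have hS_apply : ∀ (u : ℝ → ℝ) (hum : Measurable u) (huC : ∀ y, |u y| ≤ C) (f : D') (y : ℝ),
      ((S u hum huC f : D') : ℝ → ℂ) y = ((Real.sqrt (u y) : ℝ) : ℂ) * (f : ℝ → ℂ) y := fun _ _ _ _ _ ↦ rfl
  let Sw : D' →ₗ[ℝ] D' := S w hwm hwC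
  let Sn : D' →ₗ[ℝ] D' := S n hnm hnC
  have hSw : ∀ (f h : D'), ip (Sw f) (Sw h) = ∫ y, w y * ((f : ℝ → ℂ) y * conj ((h : ℝ → ℂ) y)).re := by
    intro f h; rw [hip]
    exact integral_congr_ae (Eventually.of_forall fun y ↦ by
      simp only [Sw, hS_apply]; exact dt_sqrt_mul_pairing_pt hw0 _ _ y)
  have hSn : ∀ (h : D'), ip (Sn h) (Sn h) = ∫ y, n y * ‖(h : ℝ → ℂ) y‖ ^ 2 := by
    intro h; rw [hip]
    exact integral_congr_ae (Eventually.of_forall fun y ↦ by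
      simp only [Sn, hS_apply]; rw [dt_sqrt_mul_pairing_pt hn0 _ _ y, re_mul_conj_self])
  have hSmix : ∀ (f h : D'), ip (Sw f) (Sn h) = ip f h := by
    intro f h; rw [hip, hip]
    exact integral_congr_ae (Eventually.of_forall fun y ↦ by
      simp only [Sw, Sn, hS_apply]; exact dt_sqrt_mixed_pairing_pt hw0 hwn _ _ y)
  -- the closed form on `D`
  let E : D →ₗ[ℝ] D →ₗ[ℝ] ℝ := LinearMap.mk₂ ℝ
    (fun f h ↦ weilPoleForm₂ (f : ℝ → ℂ) h + weilDirichletEnergy₂ c (f : ℝ → ℂ) h -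
      weilMarkovConstant c * ∫ x, ((f : ℝ → ℂ) x * conj ((h : ℝ → ℂ) x)).re)
    (fun f₁ f₂ h ↦ by
      simp only [Submodule.coe_add]
      exact dt_closedForm_add_left c f₁.2.1 f₂.2.1 h.2.1 f₁.2.2.1 f₂.2.2.1 f₁.2.2.2.2.2 f₂.2.2.2.2.2
        h.2.2.2.2.2)
    (fun a f h ↦ by
      simp only [Submodule.coe_smul, smul_eq_mul]
      exact dt_closedForm_smul_left c a _ _)
    (fun f h₁ h₂ ↦ by
      simp only [Submodule.coe_add]
      rw [dt_closedForm_comm, dt_closedForm_add_left c h₁.2.1 h₂.2.1 f.2.1 h₁.2.2.1 h₂.2.2.1 h₁.2.2.2.2.2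
        h₂.2.2.2.2.2 f.2.2.2.2.2, dt_closedForm_comm c (h₁ : ℝ → ℂ), dt_closedForm_comm c (h₂ : ℝ → ℂ)])
    (fun a f h ↦ by
      simp only [Submodule.coe_smul, smul_eq_mul]
      rw [dt_closedForm_comm, dt_closedForm_smul_left, dt_closedForm_comm])
  have hE : ∀ f h : D, E f h = weilPoleForm₂ (f : ℝ → ℂ) h + weilDirichletEnergy₂ c (f : ℝ → ℂ) h -
      weilMarkovConstant c * ∫ x, ((f : ℝ → ℂ) x * conj ((h : ℝ → ℂ) x)).re := fun f h ↦ rfl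
  -- the vectors
  let vD : Fin k → D := fun i ↦ ⟨v i, hv i⟩
  let FD : Fin k → D' := fun i ↦ ⟨F i, hF i⟩
  let rD : Fin k → D' := fun i ↦ FD i - ∑ l, W i l • ι (vD l)
  have hcoeι : ∀ f : D, ((ι f : D') : ℝ → ℂ) = (f : ℝ → ℂ) := fun f ↦ rfl
  -- the penalty functional `ℓ(f) = Σ_l c_l ∫Re(v_l f̄)` and the penalised form `E' = E + K ℓ ⊗ ℓ`
  let ℓ : D →ₗ[ℝ] ℝ := ∑ l, cv l • ((ip (ι (vD l))).comp ι)
  have hℓ : ∀ f : D, ℓ f = ∑ l, cv l * ∫ x, (v l x * conj ((f : ℝ → ℂ) x)).re := by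
    intro f
    simp only [ℓ, LinearMap.coe_sum, Finset.sum_apply, LinearMap.smul_apply, LinearMap.coe_comp,
      Function.comp_apply, smul_eq_mul, hip, hcoeι]
    rfl
  let E' : D →ₗ[ℝ] D →ₗ[ℝ] ℝ := E + K • (LinearMap.mul ℝ ℝ).compl₁₂ ℓ ℓ
  have hE' : ∀ f h : D, E' f h = E f h + K * (ℓ f * ℓ h) := by
    intro f h
    simp only [E', LinearMap.add_apply, LinearMap.smul_apply, LinearMap.compl₁₂_apply, LinearMap.mul_apply',
      smul_eq_mul]
  have hgD : g ∈ D := ⟨hg, hgs, hgr, hgp, hgE⟩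
  obtain ⟨α, hα⟩ := dt_exists_orthogonal_decomp v (fun i ↦ (hv i).1) (fun i ↦ (hv i).2.2.1) hg hgr
  have hhD : g - ∑ i, α i • v i ∈ D :=
    D.sub_mem hgD (D.sum_mem fun i _ ↦ D.smul_mem (α i) (hv i))
  let gD : D := ⟨g, hgD⟩
  let hD : D := ⟨g - ∑ i, α i • v i, hhD⟩
  have hdecomp : gD = (∑ i, α i • vD i) + hD := by
    apply Subtype.ext
    simp only [Submodule.coe_add, Submodule.coe_sum, Submodule.coe_smul, gD, hD, vD]
    abel
  have horth : ∀ j, ip (ι (vD j)) (ι hD) = 0 := fun j ↦ by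
    rw [hip, hcoeι, hcoeι]; exact hα j
  have hcoer : ∀ i, ((rD i : D') : ℝ → ℂ) = F i - ∑ l, W i l • v l := fun i ↦ by
    simp only [rD, FD, Submodule.coe_sub, Submodule.coe_sum, Submodule.coe_smul, hcoeι, vD]
  -- the penalty functional vanishes on the complement of the trial span
  have hℓ0 : ∀ h : D, (∀ j, ip (ι (vD j)) (ι h) = 0) → ℓ h = 0 := by
    intro h hh
    rw [hℓ]
    refine Finset.sum_eq_zero fun l _ ↦ ?_
    have := hh l
    rw [hip, hcoeι, hcoeι] at this
    rw [this, mul_zero]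
  -- apply the abstract lemma to the penalised form
  have key := dt_deflatedFormBound₂W ι ip E'
    (fun x y ↦ by rw [hip, hip, dt_pairing_comm])
    (fun x ↦ by rw [hip]; exact dt_pairing_self_nonneg _)
    (fun x y ↦ by rw [hE', hE', hE, hE, dt_closedForm_comm, mul_comm (ℓ x) (ℓ y)])
    Sw Sn hSmix vD rD lam ?_ ?_ ?_ hdecomp horth
  · -- conclusion
    rw [hip, hE', hE, hcoeι, hℓ] at key
    simpa only [gD, weilPoleForm₂_self, weilDirichletEnergy₂_self, dt_pairing_self, ← sq] using key
  · -- (repr)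
    intro i h hh
    have h0 : ∀ l, ∫ x, (v l x * conj ((h : ℝ → ℂ) x)).re = 0 := fun l ↦ by
      have := hh l; rwa [hip, hcoeι, hcoeι] at this
    rw [hE', hℓ0 h hh, mul_zero, mul_zero, add_zero, hE,
      hrepr i h h.2.1 h.2.2.1 h.2.2.2.1 h.2.2.2.2.1 h.2.2.2.2.2]
    rw [show ip (rD i) (ι h) = ip (FD i) (ι h) - ∑ l, W i l * ip (ι (vD l)) (ι h) by
      simp only [rD, map_sub, LinearMap.sub_apply, dt_bilin_sum_smul_left]]
    have hF0 : ip (FD i) (ι h) = ∫ x, (F i x * conj ((h : ℝ → ℂ) x)).re := rfl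
    have hv0 : ∀ l, ip (ι (vD l)) (ι h) = 0 := fun l ↦ by rw [hip, hcoeι, hcoeι]; exact h0 l
    simp only [hF0, hv0, mul_zero, Finset.sum_const_zero, sub_zero]
  · -- (weighted β): the penalty vanishes on `h ⊥ v`
    intro h hh
    have h0 : ∀ l, ∫ x, (v l x * conj ((h : ℝ → ℂ) x)).re = 0 := fun l ↦ by
      have := hh l; rwa [hip, hcoeι, hcoeι] at this
    rw [hSn, hip, hE', hℓ0 h hh, mul_zero, mul_zero, add_zero, hE, hcoeι, dt_closedForm_self, dt_pairing_self]
    exact hbeta h h.2.1 h.2.2.1 h.2.2.2.1 h.2.2.2.2.1 h.2.2.2.2.2 h0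
  · -- (PSD) with the rank-one penalty
    intro α'
    have e : ∀ i j, E' (vD i) (vD j) - lam * ip (ι (vD i)) (ι (vD j)) - ip (Sw (rD i)) (Sw (rD j)) =
        (weilPoleForm₂ (v i) (v j) + weilDirichletEnergy₂ c (v i) (v j) -
          weilMarkovConstant c * ∫ x, (v i x * conj (v j x)).re) - lam * (∫ x, (v i x * conj (v j x)).re) -
        (∫ y, w y * ((F i - ∑ l, W i l • v l) y * conj ((F j - ∑ l, W j l • v l) y)).re) +
        K * ((∑ l, cv l * ∫ x, (v l x * conj (v i x)).re) * (∑ l, cv l * ∫ x, (v l x * conj (v j x)).re)) := by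
      intro i j
      rw [hE', hE, hip, hSw, hcoeι, hcoeι, hcoer, hcoer, hℓ, hℓ]
      ring
    simp only [e]
    exact hPSD α'

/-! ## The penalty on a complex test splits into real and imaginary parts -/

/-- For real-valued `v_l` and a square-integrable `φ` with real and imaginary parts `φ_R = Re φ`, `φ_I = Im φ`
(as complex-valued functions): `|Σ_l c_l ∫ φ v̄_l|² = (Σ_l c_l ∫Re(v_l φ̄_R))² + (Σ_l c_l ∫Re(v_l φ̄_I))²`. [folklore] -/
theorem gc_penalty_split {k : ℕ} (v : Fin k → ℝ → ℂ) (cv : Fin k → ℝ) {φ : ℝ → ℂ} (hφ : MemLp φ 2)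
    (hv : ∀ l, MemLp (v l) 2) (hvr : ∀ l x, (v l x).im = 0) :
    ‖∑ l, (cv l : ℂ) * ∫ x, φ x * conj (v l x)‖ ^ 2 =
      (∑ l, cv l * ∫ x, (v l x * conj (((φ x).re : ℝ) : ℂ)).re) ^ 2 +
        (∑ l, cv l * ∫ x, (v l x * conj (((φ x).im : ℝ) : ℂ)).re) ^ 2 := by
  -- each pairing `∫ φ v̄_l` has real part `∫ Re(v_l φ̄_R)` and imaginary part `∫ Re(v_l φ̄_I)`
  have hint : ∀ l, Integrable fun x ↦ φ x * conj (v l x) := fun l ↦ hφ.integrable_mul (memLp_conj (hv l))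
  have hre : ∀ l, (∫ x, φ x * conj (v l x)).re = ∫ x, (v l x * conj (((φ x).re : ℝ) : ℂ)).re := by
    intro l
    have h1 := integral_re (hint l)
    simp only [RCLike.re_to_complex] at h1
    rw [← h1]
    refine integral_congr_ae (Eventually.of_forall fun x ↦ ?_)
    simp only [Complex.mul_re, Complex.conj_re, Complex.conj_im, Complex.ofReal_re, Complex.ofReal_im, hvr l x]
    ring
  have him : ∀ l, (∫ x, φ x * conj (v l x)).im = ∫ x, (v l x * conj (((φ x).im : ℝ) : ℂ)).re := by
    intro l
    have h1 := integral_im (hint l)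
    simp only [RCLike.im_to_complex] at h1
    rw [← h1]
    refine integral_congr_ae (Eventually.of_forall fun x ↦ ?_)
    simp only [Complex.mul_im, Complex.mul_re, Complex.conj_re, Complex.conj_im, Complex.ofReal_re,
      Complex.ofReal_im, hvr l x]
    ring
  have hsumre : (∑ l, (cv l : ℂ) * ∫ x, φ x * conj (v l x)).re =
      ∑ l, cv l * ∫ x, (v l x * conj (((φ x).re : ℝ) : ℂ)).re := by
    rw [Complex.re_sum]
    exact Finset.sum_congr rfl fun l _ ↦ by rw [Complex.re_ofReal_mul, hre l]
  have hsumim : (∑ l, (cv l : ℂ) * ∫ x, φ x * conj (v l x)).im =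
      ∑ l, cv l * ∫ x, (v l x * conj (((φ x).im : ℝ) : ℂ)).re := by
    rw [Complex.im_sum]
    exact Finset.sum_congr rfl fun l _ ↦ by rw [Complex.im_ofReal_mul, him l]
  rw [← Complex.normSq_eq_norm_sq, Complex.normSq_apply, hsumre, hsumim]
  ring

/-! ## The bound with penalty on smooth sector tests -/

/-- **Deflated Temple bound with a rank-one penalty on smooth sector tests (parity `σ = ±1`).**  Under the data of
`dt_sector_bound_w` (trial vectors with window images, coefficients `W`, certificate `(n, λ, μ)` on smooth sector tests,
weights `w n = 1`) plus a real `K`, coefficients `c_l`, and the PENALISED kernel datum `A − λG − R_w + K d dᵀ ⪰ 0`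
(`d_i = Σ_l c_l ∫Re(v_l v̄_i)`): every smooth test `φ` supported in `[-c, c]` with `φ(-x) = σ φ(x)` satisfies
`λ ∫|φ|² ≤ Re Q(φ) + K |Σ_l c_l ∫ φ v̄_l|²` — a one-direction DEFLATION-SHAPE GAP CERTIFICATE along `ψ = Σ_l c_l v_l`.
[cite: WeinsteinStenger1972, Ch. 5 §9 eq. (2) (k = 1: Temple's formula)] -/
theorem gc_sector_bound_wK {c : ℝ} (hc : 0 < c) (σ : ℝ) {k : ℕ} (v F : Fin k → ℝ → ℂ)
    (W : Fin k → Fin k → ℝ) (μ : Fin k → ℝ) (lam : ℝ) (hμ : ∀ i, 0 ≤ μ i) (K : ℝ) (cv : Fin k → ℝ)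
    {n w : ℝ → ℝ} (hnm : Measurable n) (hwm : Measurable w) {C : ℝ} (hnC : ∀ y, |n y| ≤ C) (hwC : ∀ y, |w y| ≤ C)
    (hn0 : ∀ y, 0 ≤ n y) (hw0 : ∀ y, 0 ≤ w y) (hwn : ∀ y, w y * n y = 1)
    (hv : ∀ i, MemLp (v i) 2 ∧ (∀ x, x ∉ Icc (-c) c → v i x = 0) ∧ (∀ x, (v i x).im = 0) ∧
      (∀ x, v i (-x) = (σ : ℂ) * v i x) ∧
      IntegrableOn (fun t ↦ weilArchDensity t * weilIncrement (v i) t) (Ioi 0))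
    (hF : ∀ i, MemLp (F i) 2)
    (hrepr : ∀ i (f : ℝ → ℂ), MemLp f 2 → (∀ x, x ∉ Icc (-c) c → f x = 0) → (∀ x, (f x).im = 0) →
      (∀ x, f (-x) = (σ : ℂ) * f x) →
      IntegrableOn (fun t ↦ weilArchDensity t * weilIncrement f t) (Ioi 0) →
      weilPoleForm₂ (v i) f + weilDirichletEnergy₂ c (v i) f -
          weilMarkovConstant c * ∫ x, (v i x * conj (f x)).re = ∫ x, (F i x * conj (f x)).re)
    (hcert : ∀ φ : ℝ → ℂ, IsWeilTest φ → tsupport φ ⊆ Icc (-c) c → (∀ x, φ (-x) = (σ : ℂ) * φ x) →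
      (∫ y, n y * ‖φ y‖ ^ 2) + lam * ∫ x, ‖φ x‖ ^ 2 ≤
        (weilQuadratic φ).re + ∑ i, μ i * ‖∫ x, φ x * conj (v i x)‖ ^ 2)
    (hPSD : ∀ α : Fin k → ℝ, 0 ≤ ∑ i, ∑ j, α i * α j *
      ((weilPoleForm₂ (v i) (v j) + weilDirichletEnergy₂ c (v i) (v j) -
          weilMarkovConstant c * ∫ x, (v i x * conj (v j x)).re) - lam * (∫ x, (v i x * conj (v j x)).re) -
        (∫ y, w y * ((F i - ∑ l, W i l • v l) y * conj ((F j - ∑ l, W j l • v l) y)).re) +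
        K * ((∑ l, cv l * ∫ x, (v l x * conj (v i x)).re) * (∑ l, cv l * ∫ x, (v l x * conj (v j x)).re))))
    {φ : ℝ → ℂ} (hφ : IsWeilTest φ) (hφs : tsupport φ ⊆ Icc (-c) c) (hφp : ∀ x, φ (-x) = (σ : ℂ) * φ x) :
    lam * ∫ x, ‖φ x‖ ^ 2 ≤ (weilQuadratic φ).re + K * ‖∑ l, (cv l : ℂ) * ∫ x, φ x * conj (v l x)‖ ^ 2 := by
  -- adapted from EvenWinsBeyondArch.dt_sector_bound_w
  have hbeta : ∀ h : ℝ → ℂ, MemLp h 2 → (∀ x, x ∉ Icc (-c) c → h x = 0) → (∀ x, (h x).im = 0) →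
      (∀ x, h (-x) = (σ : ℂ) * h x) →
      IntegrableOn (fun t ↦ weilArchDensity t * weilIncrement h t) (Ioi 0) →
      (∀ j, ∫ x, (v j x * conj (h x)).re = 0) →
      (∫ y, n y * ‖h y‖ ^ 2) + lam * ∫ x, ‖h x‖ ^ 2 ≤
        weilPoleForm h + weilDirichletEnergy c h - weilMarkovConstant c * ∫ x, ‖h x‖ ^ 2 := by
    intro h hh hhs hhr hhp hhE h0
    exact dt_beta_transfer_w hc (σ : ℂ) v (fun i ↦ (hv i).1) μ hμ lam hnm hnC hn0 hcert hh hhs hhp hhE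
      fun i ↦ dt_integral_mul_conj_eq_zero_of_real hh (hv i).1 hhr (hv i).2.2.1 (h0 i)
  have hreal : ∀ r : ℝ → ℂ, IsWeilTest r → tsupport r ⊆ Icc (-c) c → (∀ x, (r x).im = 0) →
      (∀ x, r (-x) = (σ : ℂ) * r x) →
      lam * ∫ x, ‖r x‖ ^ 2 ≤ (weilQuadratic r).re + K * (∑ l, cv l * ∫ x, (v l x * conj (r x)).re) ^ 2 := by
    intro r hr hrs hrr hrp
    have hrs' : ∀ x, x ∉ Icc (-c) c → r x = 0 := fun x hx ↦
      image_eq_zero_of_notMem_tsupport fun hm ↦ hx (hrs hm)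
    have h := gc_deflation_core_wK (σ : ℂ) v F W lam K cv hnm hwm hnC hwC hn0 hw0 hwn hv hF hrepr hbeta hPSD
      hr.memLp_two hrs' hrr hrp (integrableOn_weilArchDensity_mul_weilIncrement hr)
    rwa [← weilQuadratic_re_eq_weilPoleForm_add_weilDirichletEnergy_sub hr hrs] at h
  set gR : ℝ → ℂ := fun x ↦ ((φ x).re : ℂ) with hgR
  set gI : ℝ → ℂ := fun x ↦ ((φ x).im : ℂ) with hgI
  have hR := hreal gR (isWeilTest_rePart hφ) ((tsupport_rePart_subset φ).trans hφs)
    (fun x ↦ by simp [hgR]) (fun x ↦ by simp [hgR, hφp x])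
  have hI := hreal gI (isWeilTest_imPart hφ) ((tsupport_imPart_subset φ).trans hφs)
    (fun x ↦ by simp [hgI]) (fun x ↦ by simp [hgI, hφp x])
  rw [re_weilQuadratic_eq_rePart_add_imPart hφ, ← integral_norm_sq_rePart_add_imPart hφ.memLp_two,
    gc_penalty_split v cv hφ.memLp_two (fun l ↦ (hv l).1) (fun l x ↦ (hv l).2.2.1 x)]
  simp only [hgR, hgI] at hR hI
  nlinarith [hR, hI]

end Summit.RiemannHypothesis.RiemannHypothesis.Theorems.PolarPerronFrobenius

end
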